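import Mathlib
import Literature.NumberTheory.LFunctions.Zhang2022.Section12Ded1217ErrorTerms
import Literature.NumberTheory.LFunctions.Zhang2022.TypedSection12B
import HarnessLib

/-!
# Zhang (2022) §12, discharge layer IV: (12.9) from Lemma 8.1; (12.17) from the typed §12 leaves — `Ded129`, `Ded1217fine`, `Ded1217`

Topic `Literature/NumberTheory/LFunctions/Zhang2022` (Landau–Siegel audit tree; verdict-neutral).
Y. Zhang, *Discrete mean estimates and the Landau–Siegel zero*, arXiv:2211.02515v1 (2022)
[Zhang2022LandauSiegel]. **Status of the source: an unrefereed manuscript under adjudication** (campaign D-0069, cell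
siegel-zhang). Everything in this file is PROVED (theorems only; no new definitions, no new facts);
nothing here is a claim about Theorems 1–2 of the source or about Landau–Siegel zeros.

Fourth file of the §12 discharge (DAG nodes `Z22:(12.9)`, `Z22:(12.17)`; cone leaf C33
`Skeleton.Ded1217 c′`). KERNEL EDGES PROVED:

* `ded129_holds : Typed.Sec12A.Ded129 c′` — **"This implies, by Lemma 8.1, (12.9)"** (p. 68, tex L3452)
  HOLDS: `Xi15Hbar16 → Skeleton.Lemma81 c′ → Eq129`. Ingredients: `H₂ = A(𝐚₁₂;·)` ((9.2),
  `Apoly_a12_eq_H2`), **`H̄₁₆(·,ψ̄) = A(𝐚₂₅;·,ψ̄)`** (`ApolyBar_a25_eq_Hbar16`: `conj ϰ₁₃` flips the sign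
  of the purely imaginary `β₆`; `P″₂ ≤ PT⁻²`), `conj 𝐚₂₅ = 𝐚₁₅`, `conj 𝐚₁₂ = 𝐚₂₂`, and (7.2) for the four
  sequences (`SkeletonReductions.adm72_a12/a22`, layer I `adm72_a15/a25`).
* `theta1_slack_pt`, `mainMV_eq_weighted` — the generic "by Proposition 7.1" passage from the weighted
  sum `(2α)⁻¹S₁ + 2α⁻¹S₂ + (3/2α)S₃ = 𝔞(M + δ) + o(1)` to `Θ₁ = M𝔞𝔓 + O(δ𝔞𝔓) + o(𝔓)`, WITH the `10⁻⁵`-type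
  slack the §12 evaluations carry.
* `eval1217_core`, **`eval1217_of_typed : Prop71 c′ → Eq129 c′ → Eq1212 c′ → Mid1225 c′ → Eq1214 c′ →
  Eq1215 c′ → Low1522 c′ → Step12u049 c′ → Eq1216 c′ → Skeleton.Eval1217 c′`** — (12.17) from the typed
  leaves; the two `ε/2` of (12.15), (12.16) add to the `ε` of (12.17) exactly as printed (so the `1e-5`
  slack of `Skeleton.Eval1217` follows from the typed `1e-5/2` slacks of `Eq1215`, `Eq1216`); the TACIT
  inputs of "by Proposition 7.1" — (7.2)-admissibility and `E(𝐚₁₂,𝐚₂₅), E(𝐚₁₅,𝐚₂₂) = o(𝔓)` — are PROVED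
  (layers I–III), not assumed.
* `ded1217fine_of_ecal`, **`ded1217fine_of_ranges : Eq1212 c′ → Mid1225 c′ → Eq1214 c′ → Low1522 c′ →
  Step12u049 c′ → Typed.Sec12C.Ded1217fine c′`** — the typed finer deduction node of L3-t9 holds once the
  error terms are negligible (it omits that tacit input; supplied here from the range claims).
* **`ded1217_of_typed : Xi15Hbar16 c′ → Eq1212 c′ → Mid1225 c′ → Eq1214 c′ → Eq1215 c′ → Low1522 c′ →
  Step12u049 c′ → Eq1216 c′ → Skeleton.Ded1217 c′`** — REFINES the leaf `hD1217` of
  `Skeleton.theorem1_of_leaves` to typed CLAIM nodes of §12 (`Xi15Hbar16 ⇐ Ded1214` is L3-t4's node).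

What is NOT asserted: any of the typed CLAIM/NUM nodes ((12.12)–(12.16), u049, `Xi15Hbar16`), Prop. 7.1,
Lemma 8.1, or any statement about Theorems 1–2 / Landau–Siegel zeros. The ε-bookkeeping INSIDE
(12.13)→(12.14)→(12.15) (printed `ε/10`, `ε/4`, `ε/2`) is not used here (the chain starts at (12.14),
(12.15), (12.16) as typed) and is audited separately.

## References

* Y. Zhang, arXiv:2211.02515v1 (2022), §12 pp. 66–73, (12.9), (12.12)–(12.17); §7 Prop. 7.1 p. 33;
  §8 Lemma 8.1 p. 42. [cite: Zhang2022LandauSiegel, §12 (12.9)–(12.17)]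
-/

noncomputable section

open Complex Real ComplexConjugate
open Literature.NumberTheory.LFunctions.Zhang2022
open Literature.NumberTheory.LFunctions.Zhang2022.Skeleton
open Literature.NumberTheory.LFunctions.Zhang2022.Typed.Sec12A
open Literature.NumberTheory.LFunctions.Zhang2022.Typed.Sec12C

namespace Literature.NumberTheory.LFunctions.Zhang2022.Sec12D

/-! ## "By Proposition 7.1": from the weighted `S_j`-sum to `Θ₁`, with the `10⁻⁵` slack -/

section Theta

variable (c' : ℝ) {D : ℕ} [NeZero D] (χ : DirichletCharacter ℂ D)

omit [NeZero D] in
/-- The main term of Proposition 7.1 is the weighted sum `(2α)⁻¹S₁ + 2α⁻¹S₂ + (3/2α)S₃` times `𝔓`.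
[cite: Zhang2022LandauSiegel, §7 Prop. 7.1 p.33] -/
theorem mainMV_eq_weighted (hD : 1 ≤ Real.log D) (a₁ a₂ : ℕ → ℂ) :
    mainMV c' D a₁ a₂ =
      (1 / (2 * alpha D) * Sj c' D 1 a₁ a₂ + 2 / alpha D * Sj c' D 2 a₁ a₂ +
        3 / (2 * alpha D) * Sj c' D 3 a₁ a₂ : ℂ) * frakP D := by
  have hα : (alpha D : ℂ) ≠ 0 := by exact_mod_cast (alpha_pos_of_log hD).ne'
  rw [mainMV]
  field_simp

/-- **The `ε/3`-bookkeeping of "by Proposition 7.1" with a slack**: if `‖Θ − main‖ ≤ C·E + e₁𝔓`,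
`main = W𝔓`, `‖W − 𝔞M‖ ≤ 𝔞δ + e₂` and `E ≤ e₃𝔓`, then `‖Θ − 𝔞M𝔓‖ ≤ 𝔞δ𝔓 + (|C|e₃ + e₁ + e₂)𝔓`.
[cite: Zhang2022LandauSiegel, §12 (12.17) p.73; §7 Prop. 7.1] -/
theorem theta1_slack_pt {T mv W M : ℂ} {A P E C δ e1 e2 e3 : ℝ} (hP : 0 ≤ P) (hE : 0 ≤ E)
    (h1 : ‖T - mv‖ ≤ C * E + e1 * P) (hmv : mv = W * (P : ℂ)) (h2 : ‖W - (A : ℂ) * M‖ ≤ A * δ + e2)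
    (h3 : E ≤ e3 * P) :
    ‖T - (A : ℂ) * M * (P : ℂ)‖ ≤ A * δ * P + (|C| * e3 + e1 + e2) * P := by
  have e : T - (A : ℂ) * M * (P : ℂ) = (T - mv) + (W - (A : ℂ) * M) * (P : ℂ) := by rw [hmv]; ring
  have hCE : C * E ≤ |C| * (e3 * P) :=
    (mul_le_mul_of_nonneg_right (le_abs_self C) hE).trans (mul_le_mul_of_nonneg_left h3 (abs_nonneg C))
  rw [e]
  calc ‖(T - mv) + (W - (A : ℂ) * M) * (P : ℂ)‖ ≤ ‖T - mv‖ + ‖(W - (A : ℂ) * M) * (P : ℂ)‖ :=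
        norm_add_le _ _
    _ = ‖T - mv‖ + ‖W - (A : ℂ) * M‖ * P := by
        rw [norm_mul, Complex.norm_real, Real.norm_of_nonneg hP]
    _ ≤ (C * E + e1 * P) + (A * δ + e2) * P := by gcongr
    _ ≤ A * δ * P + (|C| * e3 + e1 + e2) * P := by nlinarith

/-- `|C|·(η/(|C|+1)) ≤ η` for `η ≥ 0`. [folklore] -/
private theorem abs_mul_div_succ_le (C : ℝ) {η : ℝ} (hη : 0 ≤ η) : |C| * (η / (|C| + 1)) ≤ η := by
  have h1 : 0 < |C| + 1 := by positivity
  rw [mul_div_assoc', div_le_iff₀ h1]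
  nlinarith [abs_nonneg C]

/-- **(12.17) from Proposition 7.1, (12.9), (12.15), (12.16) and the negligibility of the two error
terms** `E(𝐚₁₂,𝐚₂₅)`, `E(𝐚₁₅,𝐚₂₂)` (the core of "Finally, by (12.9), (12.15) and (12.16) we conclude
(12.17)", p. 73, tex L3713): `Ξ₁₅ = (e₁* + 2e₂*)𝔞𝔓` within `10⁻⁵𝔞𝔓 + o(𝔓)` — the two printed `ε/2`
slacks add to the `ε` of (12.17) EXACTLY as printed. Kernel-checked `ε/7`-bookkeeping.
[cite: Zhang2022LandauSiegel, §12 (12.17) p.73] -/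
theorem eval1217_core (h71 : Prop71 c') (h129 : Eq129 c') (h1215 : Eq1215 c') (h1216 : Eq1216 c')
    (hE1 : ∀ ε : ℝ, 0 < ε → ForAllLarge fun D _ χ => AssumptionA D χ →
      Ecal c' D (a12 χ) (a25 χ) ≤ ε * frakP D)
    (hE2 : ∀ ε : ℝ, 0 < ε → ForAllLarge fun D _ χ => AssumptionA D χ →
      Ecal c' D (a15 χ) (a22 χ) ≤ ε * frakP D) :
    Eval1217 c' := by
  intro ε hε
  set η := ε / 7 with hη
  have hη0 : 0 < η := by positivity
  set B := max (‖iota3‖ + ‖iota4‖) 1 with hB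
  obtain ⟨C, h71'⟩ := h71 B η hη0
  have hC1 : 0 < |C| + 1 := by positivity
  obtain ⟨D₀, hall⟩ := (((((h71'.and (h129 η hη0)).and (h1215 η hη0)).and (h1216 η hη0)).and
    ((hE1 (η / (|C| + 1)) (by positivity)).and (hE2 (η / (|C| + 1)) (by positivity)))).and
    (forAllLarge_log_ge 4))
  refine ⟨D₀, fun D _ χ hD hq hp hA => ?_⟩
  obtain ⟨⟨⟨⟨⟨h71D, h129D⟩, h1215D⟩, h1216D⟩, ⟨hE1D, hE2D⟩⟩, hlog4⟩ := hall D χ hD hq hp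
  have hlog2 : 2 ≤ Real.log D := by linarith
  have hlog3 : 3 ≤ Real.log D := by linarith
  have hD1 : 1 ≤ Real.log D := by linarith
  have hP := frakP_nonneg D
  have hAf := frakA_nonneg χ
  -- admissibility (7.2) of the four sequences, with the common bound `B`
  have adm12 : Adm72 D B (a12 χ) := adm72_mono (le_max_left _ _) (adm72_a12 χ hlog2)
  have adm22 : Adm72 D B (a22 χ) := adm72_mono (le_max_left _ _) (adm72_a22 χ hlog2)
  have adm25 : Adm72 D B (a25 χ) := adm72_mono (le_max_right _ _) (adm72_a25 χ hlog3)
  have adm15 : Adm72 D B (a15 χ) := adm72_mono (le_max_right _ _) (adm72_a15 χ hlog3)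
  -- Proposition 7.1 at the two pairs
  have t1 := h71D hA (a12 χ) (a25 χ) adm12 adm25
  have t2 := h71D hA (a15 χ) (a22 χ) adm15 adm22
  -- (12.15), (12.16)
  have w1 := h1215D hA (a25 χ) (fun n => rfl)
  have w2 := h1216D hA (a15 χ) (fun n => rfl)
  -- the error terms
  have E1 := hE1D hA
  have E2 := hE2D hA
  have hEnn : ∀ a₁ a₂ : ℕ → ℂ, 0 ≤ Ecal c' D a₁ a₂ := fun a₁ a₂ => by
    unfold Ecal; exact mul_nonneg (mul_nonneg hP (sq_nonneg _)) (by positivity)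
  have hCη := abs_mul_div_succ_le C hη0.le
  -- `Θ₁(𝐚₁₂,𝐚₂₅)` and `Θ₁(𝐚₁₅,𝐚₂₂)` within `½·10⁻⁵𝔞𝔓 + 3η𝔓`
  have s1 := theta1_slack_pt hP (hEnn _ _) t1 (mainMV_eq_weighted c' hD1 (a12 χ) (a25 χ)) w1 E1
  have s2 := theta1_slack_pt hP (hEnn _ _) t2 (mainMV_eq_weighted c' hD1 (a15 χ) (a22 χ)) w2 E2
  have r := h129D hA
  -- the exact decomposition behind (12.17)
  have key : xi15 c' χ - (e1star + 2 * e2star) * frakA χ * frakP D =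
      (xi15 c' χ - (Theta1 c' χ (a12 χ) (a25 χ) + conj (Theta1 c' χ (a15 χ) (a22 χ)))) +
      (Theta1 c' χ (a12 χ) (a25 χ) - (frakA χ : ℂ) * (e1star + e2star) * (frakP D : ℂ)) +
      conj (Theta1 c' χ (a15 χ) (a22 χ) - (frakA χ : ℂ) * conj e2star * (frakP D : ℂ)) := by
    rw [map_sub, map_mul, map_mul, Complex.conj_ofReal, Complex.conj_ofReal, Complex.conj_conj]
    ring
  rw [key]
  calc ‖(xi15 c' χ - (Theta1 c' χ (a12 χ) (a25 χ) + conj (Theta1 c' χ (a15 χ) (a22 χ)))) +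
        (Theta1 c' χ (a12 χ) (a25 χ) - (frakA χ : ℂ) * (e1star + e2star) * (frakP D : ℂ)) +
        conj (Theta1 c' χ (a15 χ) (a22 χ) - (frakA χ : ℂ) * conj e2star * (frakP D : ℂ))‖
      ≤ ‖xi15 c' χ - (Theta1 c' χ (a12 χ) (a25 χ) + conj (Theta1 c' χ (a15 χ) (a22 χ)))‖ +
        ‖Theta1 c' χ (a12 χ) (a25 χ) - (frakA χ : ℂ) * (e1star + e2star) * (frakP D : ℂ)‖ +
        ‖conj (Theta1 c' χ (a15 χ) (a22 χ) - (frakA χ : ℂ) * conj e2star * (frakP D : ℂ))‖ :=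
        norm_add₃_le
    _ = ‖xi15 c' χ - (Theta1 c' χ (a12 χ) (a25 χ) + conj (Theta1 c' χ (a15 χ) (a22 χ)))‖ +
        ‖Theta1 c' χ (a12 χ) (a25 χ) - (frakA χ : ℂ) * (e1star + e2star) * (frakP D : ℂ)‖ +
        ‖Theta1 c' χ (a15 χ) (a22 χ) - (frakA χ : ℂ) * conj e2star * (frakP D : ℂ)‖ := by
        rw [Complex.norm_conj]
    _ ≤ η * frakP D + (frakA χ * (1e-5 / 2) * frakP D + (|C| * (η / (|C| + 1)) + η + η) * frakP D) +
        (frakA χ * (1e-5 / 2) * frakP D + (|C| * (η / (|C| + 1)) + η + η) * frakP D) := by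
        gcongr
    _ ≤ η * frakP D + (frakA χ * (1e-5 / 2) * frakP D + (η + η + η) * frakP D) +
        (frakA χ * (1e-5 / 2) * frakP D + (η + η + η) * frakP D) := by
        gcongr
    _ = 1e-5 * frakA χ * frakP D + ε * frakP D := by rw [hη]; ring

/-- **(12.17) from the typed leaves of §12** — Proposition 7.1, (12.9), and the range evaluations (12.12),
"middle range `o(α)`", (12.14), (12.15) for `Θ₁(𝐚₁₂,𝐚₂₅)` and "first sum `o(α)`", u049, (12.16) for
`Θ₁(𝐚₁₅,𝐚₂₂)` — with the tacit inputs of "by Proposition 7.1" (admissibility (7.2) of `𝐚₁₂, 𝐚₂₂, 𝐚₁₅, 𝐚₂₅`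
and the negligibility of `E(·,·)`) PROVED, not assumed. This REFINES the skeleton's coarse deduction
`Ded1217` to the typed CLAIM nodes of `TypedSection12A/12C`. [cite: Zhang2022LandauSiegel, §12 (12.17) p.73] -/
theorem eval1217_of_typed (h71 : Prop71 c') (h129 : Eq129 c') (h1212 : Eq1212 c') (hMid : Mid1225 c')
    (h1214 : Eq1214 c') (h1215 : Eq1215 c') (hLow : Low1522 c') (h049 : Step12u049 c')
    (h1216 : Eq1216 c') : Eval1217 c' :=
  eval1217_core c' h71 h129 h1215 h1216 (ecal_a12_small c' h1212 hMid h1214)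
    (ecal_a15_small c' hLow h049)

/-- **`Ded1217fine` holds once the two error terms of Proposition 7.1 are negligible** — the typed
deduction node of L3-t9 (`Prop71 → (12.9)-shape → Eq1215 → Eq1216 → Eval1217`) omits the TACIT input
"`E(𝐚₁₂,𝐚₂₅), E(𝐚₁₅,𝐚₂₂) = o(𝔓)`" of "by Proposition 7.1"; with it (derivable from the range claims,
`ecal_a12_small`, `ecal_a15_small`) the deduction is kernel-checked.
[cite: Zhang2022LandauSiegel, §12 (12.17) p.73] -/
theorem ded1217fine_of_ecal
    (hE1 : ∀ ε : ℝ, 0 < ε → ForAllLarge fun D _ χ => AssumptionA D χ →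
      Ecal c' D (a12 χ) (a25 χ) ≤ ε * frakP D)
    (hE2 : ∀ ε : ℝ, 0 < ε → ForAllLarge fun D _ χ => AssumptionA D χ →
      Ecal c' D (a15 χ) (a22 χ) ≤ ε * frakP D) :
    Ded1217fine c' := by
  intro h71 h129s h1215 h1216
  have h129 : Eq129 c' := fun ε hε =>
    (h129s ε hε).mono fun D _ χ _ _ h hA => h hA (a15 χ) (a25 χ) (fun n => rfl) (fun n => rfl)
  exact eval1217_core c' h71 h129 h1215 h1216 hE1 hE2

/-- **`Ded1217fine` from the typed range claims** ((12.12), middle range, (12.14); first sum, u049).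
[cite: Zhang2022LandauSiegel, §12 (12.17) p.73] -/
theorem ded1217fine_of_ranges (h1212 : Eq1212 c') (hMid : Mid1225 c') (h1214 : Eq1214 c')
    (hLow : Low1522 c') (h049 : Step12u049 c') : Ded1217fine c' :=
  ded1217fine_of_ecal c' (ecal_a12_small c' h1212 hMid h1214) (ecal_a15_small c' hLow h049)

end Theta

/-! ## (12.9) from Lemma 8.1: `Ded129` holds -/

section Ded129

variable (c' : ℝ) {D : ℕ} [NeZero D] (χ : DirichletCharacter ℂ D) (x : Chr D)

omit [NeZero D] in
/-- `conj ψ(a) = ψ⁻¹(a)` (`ψ̄ = ψ⁻¹`). [folklore] -/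
private theorem conj_psi_eq_inv (a : ZMod x.p) : conj (x.ψ a) = x.ψ⁻¹ a := by
  rw [← MulChar.star_apply']
  rfl

omit [NeZero D] in
/-- `conj (r^m) = r^{conj m}` for a real `r ≥ 0`. [folklore] -/
private theorem conj_ofReal_cpow' {r : ℝ} (hr : 0 ≤ r) (m : ℂ) :
    conj (((r : ℝ) : ℂ) ^ m) = ((r : ℝ) : ℂ) ^ conj m := by
  have h := Complex.conj_cpow (r : ℂ) (conj m)
    (by rw [Complex.arg_ofReal_of_nonneg hr]; exact Real.pi_pos.ne)
  rw [Complex.conj_conj, Complex.conj_ofReal] at h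
  exact h.symm

omit [NeZero D] in
/-- `P″₁ ≥ 0` (for every `D`). [cite: Zhang2022LandauSiegel, §12 p. 67] -/
theorem P1pp_nonneg (D : ℕ) : 0 ≤ P1pp D := by
  rw [P1pp, t0, ell]
  exact mul_nonneg (mul_nonneg (Real.rpow_nonneg (Real.exp_pos _).le _) (Nat.cast_nonneg D))
    (pow_nonneg (Real.log_natCast_nonneg D) _)

omit [NeZero D] in
/-- **`conj ϰ₁₃(n) = (log P₁)⁻¹(n/P″₁)^{β₆}log(n/P″₁)`** on the window `P″₁ < n < P″₂` (and `0` off it):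
the exponent flips sign under conjugation because `β₆ ∈ iℝ`. [cite: Zhang2022LandauSiegel, §12 (12.9) p.68] -/
theorem conj_vk13 (n : ℕ) : conj (vk13 D n) =
    if P1pp D < n ∧ (n : ℝ) < P2pp D then
      (((Real.log (Skeleton.P1 D))⁻¹ : ℝ) : ℂ) * ((n / P1pp D : ℝ) : ℂ) ^ beta6 D *
        (Real.log (n / P1pp D) : ℂ)
    else 0 := by
  rw [vk13]
  split_ifs with h
  · have hr : 0 ≤ (n : ℝ) / P1pp D := div_nonneg n.cast_nonneg (P1pp_nonneg D)
    rw [map_mul, map_mul, Complex.conj_ofReal, Complex.conj_ofReal, conj_ofReal_cpow' hr, map_neg,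
      Typed.Sec12B.conj_beta6, neg_neg]
  · simp

omit [NeZero D] in
/-- **`A(𝐚₂₅;w,ψ̄) = H̄₁₆(w,ψ̄)`** (§12 p. 68: the Dirichlet polynomial of Lemma 8.1 built on `𝐚₂₅ = χϰ̄₁₃`
IS the `H̄₁₆` of the display before (12.9)), for real `χ` and `𝓛 ≥ 3` (so that `P″₂ ≤ PT⁻²`, the
truncation of `A`). Kernel-checked bookkeeping. [cite: Zhang2022LandauSiegel, §12 (12.9) p.68] -/
theorem ApolyBar_a25_eq_Hbar16 (hD : 3 ≤ Real.log D) (hq : χ.IsQuadratic) (w : ℂ) :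
    ApolyBar x (a25 χ) w = Hbar16 χ x w := by
  classical
  have hN := ceil_P2pp_le_Nsupp (D := D) hD
  set S := (Finset.Ico 1 ⌈P2pp D⌉₊).filter (fun n : ℕ => P1pp D < n ∧ (n : ℝ) < P2pp D) with hS
  have hsub : S ⊆ Finset.range (Nsupp D) := by
    intro n hn
    rw [hS, Finset.mem_filter, Finset.mem_Ico] at hn
    exact Finset.mem_range.mpr (lt_of_lt_of_le hn.1.2 hN)
  -- the left side, restricted to the window
  have hL : ApolyBar x (a25 χ) w = ∑ n ∈ S, a25 χ n * x.ψ⁻¹ n * (n : ℂ) ^ (-w) := by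
    rw [ApolyBar, Lemma81.dirPoly_def]
    symm
    apply Finset.sum_subset hsub
    intro n _ hn
    have hv : vk13 D n = 0 := by
      rw [vk13, if_neg]
      intro hw
      apply hn
      rw [hS, Finset.mem_filter, Finset.mem_Ico]
      refine ⟨⟨?_, Nat.lt_ceil.mpr hw.2⟩, hw⟩
      by_contra h0
      have : n = 0 := by omega
      subst this
      have := hw.1
      simp at this
      linarith [P1pp_nonneg D]
    rw [a25, a15, hv]; simp
  rw [hL, Hbar16, Finset.mul_sum]
  refine Finset.sum_congr rfl fun n hn => ?_
  simp only [Finset.mem_filter] at hn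
  rw [a25_eq_of_isQuadratic χ hq, conj_vk13, if_pos hn.2, conj_psi_eq_inv]
  push_cast
  ring

omit [NeZero D] in
/-- **The display of p. 68 IS the left side of Lemma 8.1 at `(𝐚₁₂, 𝐚₂₅)`**:
`ΣΣ𝔠*H̄₁₆(1−ρ,ψ̄)H₂(ρ,ψ)ω = ΣΣ𝔠*A(𝐚₁₂;ρ,ψ)A(𝐚₂₅;1−ρ,ψ̄)ω` (`H₂ = A(𝐚₁₂;·)` by (9.2), `H̄₁₆ = A(𝐚₂₅;·,ψ̄)`).
[cite: Zhang2022LandauSiegel, §12 (12.9) p.68] -/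
theorem xi15viaHbar16_eq_lhs81 (hD : 3 ≤ Real.log D) (hq : χ.IsQuadratic) :
    xi15viaHbar16 c' χ = lhs81 c' χ (a12 χ) (a25 χ) := by
  rw [xi15viaHbar16, lhs81]
  refine Finset.sum_congr rfl fun i _ => ?_
  rw [Apoly_a12_eq_H2 χ i.1 (by linarith), ApolyBar_a25_eq_Hbar16 χ i.1 hD hq]
  ring

/-- `log D ≥ 3` once `D ≥ 21`. [folklore] -/
private theorem three_le_log_of_le {D : ℕ} (hD : 21 ≤ D) : 3 ≤ Real.log D := by
  have h : Real.exp 3 < 21 := by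
    have h1 : Real.exp 1 ^ 3 < 2.7182818286 ^ 3 :=
      pow_lt_pow_left₀ Real.exp_one_lt_d9 (Real.exp_pos 1).le (by norm_num)
    have h3 : Real.exp 3 = Real.exp 1 ^ 3 := by rw [← Real.exp_nat_mul]; norm_num
    rw [h3]
    exact h1.trans (by norm_num)
  have hD' : (21 : ℝ) ≤ D := by exact_mod_cast hD
  rw [Real.le_log_iff_exp_le (by linarith)]
  linarith

/-- **(12.9) FOLLOWS from the display of p. 68 and Lemma 8.1** — the typed deduction node
`Sec12A.Ded129 : Xi15Hbar16 → Lemma81 → Eq129` HOLDS (kernel-checked): Lemma 8.1 at `(𝐚₁₂, 𝐚₂₅)`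
(admissible by `adm72_a12`, `adm72_a25`), the identification `xi15viaHbar16_eq_lhs81`, and
`conj 𝐚₂₅ = 𝐚₁₅`, `conj 𝐚₁₂ = 𝐚₂₂` for the reflected term. [cite: Zhang2022LandauSiegel, §12 (12.9) p.68] -/
theorem ded129_holds : Ded129 c' := by
  intro hXi h81 ε hε
  set B := max (‖iota3‖ + ‖iota4‖) 1 with hB
  obtain ⟨D₀, h⟩ := (hXi (ε / 2) (by positivity)).and (h81 B (ε / 2) (by positivity))
  refine ⟨max D₀ 21, fun D _ χ hD hq hp hA => ?_⟩
  have hD21 : 21 ≤ D := le_trans (le_max_right _ _) hD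
  have hlog3 := three_le_log_of_le hD21
  have hlog2 : 2 ≤ Real.log D := by linarith
  obtain ⟨hXiD, h81D⟩ := h D χ (le_trans (le_max_left _ _) hD) hq hp
  have adm12 : Adm72 D B (a12 χ) := adm72_mono (le_max_left _ _) (adm72_a12 χ hlog2)
  have adm25 : Adm72 D B (a25 χ) := adm72_mono (le_max_right _ _) (adm72_a25 χ hlog3)
  have key := h81D hA (a12 χ) (a25 χ) adm12 adm25
  have e1 : (fun n => conj (a25 χ n)) = a15 χ := funext fun n => by rw [a25, Complex.conj_conj]
  have e2 : (fun n => conj (a12 χ n)) = a22 χ := funext fun n => rfl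
  rw [e1, e2, ← xi15viaHbar16_eq_lhs81 c' χ hlog3 hq] at key
  have h1 := hXiD hA
  calc ‖xi15 c' χ - (Theta1 c' χ (a12 χ) (a25 χ) + conj (Theta1 c' χ (a15 χ) (a22 χ)))‖
      ≤ ‖xi15 c' χ - xi15viaHbar16 c' χ‖ +
          ‖xi15viaHbar16 c' χ - (Theta1 c' χ (a12 χ) (a25 χ) + conj (Theta1 c' χ (a15 χ) (a22 χ)))‖ :=
        norm_sub_le_norm_sub_add_norm_sub _ _ _
    _ ≤ ε / 2 * frakP D + ε / 2 * frakP D := add_le_add h1 key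
    _ = ε * frakP D := by ring

/-- `Ded129` — `_holds` alias of `ded129_holds` above under the fact's exact name (appended
2026-08-28, D-0026 bookkeeping: the proof term is the existing theorem of this file; no statement,
definition or attribute is edited; no new named fact; the ledger's debt table listed the fact
unproved). [cite: Zhang2022LandauSiegel, §12 (12.9) p.68] -/
theorem _root_.Literature.NumberTheory.LFunctions.Zhang2022.Typed.Sec12A.Ded129_holds : Ded129 c' :=
  _root_.Literature.NumberTheory.LFunctions.Zhang2022.Sec12D.ded129_holds (c' := c')

/-- **The skeleton's coarse deduction `Ded1217 c′` ("Prop 7.1 + Lemma 8.1 + Lemmas 8.2–8.4, 5.8, 12.1,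
12.3 ⇒ (12.17)") from the typed §12 leaves**: given the display of p. 68 (`Xi15Hbar16`, itself
`⇐ Ded1214`) and the range evaluations (12.12)/middle/(12.14)/(12.15) and first-sum/u049/(12.16), the
implication `Ded1217 c′` holds — its hypotheses `Prop71`, `Lemma81` are consumed (via `ded129_holds`,
`eval1217_of_typed`); Lemmas 8.2–8.4, 5.8, 12.1, 12.3 feed the range claims upstream and are not used
again here. REFINES the leaf `hD1217` of `theorem1_of_leaves`. [cite: Zhang2022LandauSiegel, §12 (12.17) p.73] -/
theorem ded1217_of_typed (hXi : Xi15Hbar16 c') (h1212 : Eq1212 c') (hMid : Mid1225 c')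
    (h1214 : Eq1214 c') (h1215 : Eq1215 c') (hLow : Low1522 c') (h049 : Step12u049 c')
    (h1216 : Eq1216 c') : Ded1217 c' :=
  fun h71 h81 _ _ _ _ _ _ =>
    eval1217_of_typed c' h71 (ded129_holds c' hXi h81) h1212 hMid h1214 h1215 hLow h049 h1216

end Ded129

end Literature.NumberTheory.LFunctions.Zhang2022.Sec12D
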